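import Mathlib.Data.ENat.Lattice
import Literature.Barriers.CriticalPhenomena.WeaklySAWCouplingFlow
import HarnessLib

/-!
# The dynamical system of [BBS-rg-flow] (Bauerschmidt–Brydges–Slade, AHP 16 (2015)) = BBS 2015, §6.1/§7.2:
# the quadratic flow `φ̄`, the `Ω`-cut-off time `j_Ω`, the weights `χ_j`, Assumptions (A1)–(A2)

Support file for the renormalisation-group half of
`Literature.Barriers.CriticalPhenomena.WeaklySAWFourDimLogCorrections` (BBS 2015, Theorem 1.1),
which the tree reduces to Theorem 4.1 of that paper (`CTWSAW.BBS2015_thm41`). In the printed proof of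
Theorem 4.1, the critical initial conditions `(z₀ᶜ, μ₀ᶜ)` and the global renormalisation-group flow
(Proposition 7.1.1) come from ONE abstract theorem of pure analysis: the main result of the companion
paper [BBS-rg-flow] (Theorem 1.4 there = Theorem 7.2.1 of BBS 2015), a stable-manifold-type theorem
for the time-dependent dynamical system `Φ_j(K_j, V_j) = (ψ_j(K_j,V_j), φ̄_j(V_j) + ρ_j(K_j,V_j))` on
`X_j = 𝒲_j ⊕ ℝ³`, a third-order perturbation of the explicit, triangular "quadratic flow" `φ̄_j` on
`ℝ³`, near the NON-HYPERBOLIC fixed point `0`, with the mixed boundary conditions `(K₀, g₀)` given,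
`(z_∞, μ_∞) = (0, 0)`. This file is the first of a series formalising [BBS-rg-flow]; it fixes the
vocabulary of its §1.1–§1.3 for the unperturbed system, in the printed generality:
* `V3`, `QuadFlowParams`, `QuadFlowParams.map` — `𝒱 = ℝ³` (sup norm) and the quadratic flow
  `φ̄_j : ℝ³ → ℝ³` of (1.1)–(1.3), parameters `η_j, γ_j, λ_j, β_j, θ_j, ζ_j, υ_j^{gg}, υ_j^{gz}, υ_j^{gμ},
  υ_j^{zz}, υ_j^{zμ}`; its `g`-component is the recursion `gbar` of `WeaklySAWCouplingFlow.lean`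
  (`QuadFlowParams.flow_apply_zero_eq_gbar`);
* `betaMax`, `jOmega`, `cutoffWeight`, `chi` — `β_max = sup_j |β_j|`, the `Ω`-cut-off time
  `j_Ω = inf{k ≥ 0 : |β_j| ≤ Ω^{-(j-k)₊} β_max ∀ j} ∈ ℕ ∪ {∞}` ((1.7); `= ∞` for constant `β ≠ 0`,
  Example 1.1(i): `jOmega_const`) and `χ_j = Ω^{-(j-j_Ω)₊}` ((1.8)), with the elementary facts used
  throughout the source: `χ_j = 1` for `j ≤ j_Ω`, `0 < χ_j ≤ 1`, `χ_{j+1} ≤ χ_j ≤ Ωχ_{j+1}`, the infimum in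
  (1.7) is attained (`jOmega_spec`), hence `|β_j| ≤ χ_jβ_max` for bounded `β` (`abs_le_chi_mul_betaMax`);
* `HypA1`, `HypA2` — Assumptions (A1), (A2) with their constants explicit (the source: "The constants in
  all estimates are permitted to depend on the constants in these assumptions, including `Ω`, but not on
  `j_Ω` and `g₀ > 0`", §1.3 — so every later statement quantifies its thresholds before the sequences);
* `IsQuadFlowBC` — "global flow of `φ̄` with initial condition `ḡ₀ = g₀` and final condition
  `(z̄_∞, μ̄_∞) = (0, 0)`" (Proposition 1.2, (2.1)).

Design notes. (1) `𝒱 = ℝ³` is `Fin 3 → ℝ` (coordinates `0 = g, 1 = z, 2 = μ`), whose Mathlib norm is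
the supremum norm, as in the source ("The norm `‖·‖_𝒱` is the supremum norm on `ℝ³`", §1.3).
(2) `(j-k)₊` in (1.7)–(1.8) is truncated subtraction of naturals, `Ω^{-(j-k)₊} = (Ω^{(j-k)₊})⁻¹`;
`cutoffWeight Ω k` is the weight for an arbitrary cut-off `k ∈ ℕ∞` (the proofs of §2 use nothing
about `j_Ω` but `|β_j| ≤ Ω^{-(j-j_Ω)₊}β_max`), `chi` its value at `k = j_Ω`. (3) In (A1) and (A2) the
source has two separate "there exists `c > 0`" (exceptional `j ≤ j_Ω` for `β_j ≥ c`, resp. `ζ_j ≤ 0`);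
a common `c` is equivalent (take the minimum: fewer than `c⁻¹` exceptions is monotone in `c`) and is
used here. (4) `β_max` is a real `iSup` (junk value `0` for unbounded `β`, excluded by (A1)).
Mapping to BBS 2015, §6.1: there `ζ_j = 0`, `υ^{gg} = ξ`, `υ^{gz} = π`, `υ^{gμ} = L²γβ_j`,
`υ^{zz} = υ^{zμ} = 0`, `λ_j = L²`, `γ_j = 0`, and `Ω = 2` ("we fix `Ω > 1` arbitrarily").

Deliberately NOT here (later files of the series): Lemma 2.1 in the printed generality (exceptional
`j`'s, weights `χ_j`; the massless/`β ≥ 0` case is `WeaklySAWCouplingFlow*.lean`), Lemma 2.2 and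
Proposition 1.2 (the massless case is `WeaklySAWQuadraticFlow.lean`), the perturbation `(ψ, ρ)`,
the domains `D_j`, Assumption (A3), Lemma 1.3 and Theorem 1.4 itself.

## References
* R. Bauerschmidt, D. C. Brydges, G. Slade, *Structural stability of a dynamical system near a
  non-hyperbolic fixed point*, Ann. Henri Poincaré 16 (2015) 1033–1065, arXiv:1211.2477: §1.1
  (1.1)–(1.3), §1.3 ((1.6)–(1.8), Example 1.1, Assumptions (A1)–(A2), Proposition 1.2), §2 (2.1).
  [BauerschmidtBrydgesSlade2015Flow]
* R. Bauerschmidt, D. C. Brydges, G. Slade, CMP 337 (2015), §6.1 (the quadratic flow (ḡ, z̄, μ̄), the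
  Ω-scale j_Ω, χ_j, Assumptions (A1)–(A2), Proposition 6.1.1), §7.2. [BauerschmidtBrydgesSlade2015LogCorr]
-/

noncomputable section

open Filter Topology Set

namespace Literature.Barriers.CriticalPhenomena

namespace CTWSAW

/-! ### The space `𝒱 = ℝ³` and the quadratic flow `φ̄` -/

/-- `𝒱 = ℝ³` with the supremum norm, coordinates `V 0 = g`, `V 1 = z`, `V 2 = μ`.
[cite: BauerschmidtBrydgesSlade2015Flow, §1.1 and §1.3 ("the norm ‖·‖_𝒱 is the supremum norm on ℝ³")] -/
abbrev V3 : Type := Fin 3 → ℝ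

/-- The real parameters of the quadratic flow `φ̄_j` ((1.1)–(1.3) of the source): the linear part
`(η_j, γ_j, λ_j)` of the `μ`-equation and the entries of the quadratic forms `q_j^g` (`β_j`), `q_j^z`
(`θ_j`, `ζ_j`) and `q_j^μ` (`υ_j^{gg}, υ_j^{gz}, υ_j^{gμ}, υ_j^{zz}, υ_j^{zμ}`).
[cite: BauerschmidtBrydgesSlade2015Flow, §1.1, (1.1)–(1.3)] -/
structure QuadFlowParams where
  /-- `η_j`, coefficient of `g` in the `μ`-equation. -/
  η : ℕ → ℝ
  /-- `γ_j`, coefficient of `z` in the `μ`-equation. -/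
  γ : ℕ → ℝ
  /-- `λ_j`, coefficient of `μ` in the `μ`-equation (the expanding direction, `λ_j ≥ λ > 1`). -/
  lam : ℕ → ℝ
  /-- `β_j`: `ḡ_{j+1} = ḡ_j - β_jḡ_j²`. -/
  β : ℕ → ℝ
  /-- `θ_j`, coefficient of `g²` in the `z`-equation. -/
  θ : ℕ → ℝ
  /-- `ζ_j`, coefficient of `gz` in the `z`-equation. -/
  ζ : ℕ → ℝ
  /-- `υ_j^{gg}`. -/
  υgg : ℕ → ℝ
  /-- `υ_j^{gz}`. -/
  υgz : ℕ → ℝ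
  /-- `υ_j^{gμ}`. -/
  υgμ : ℕ → ℝ
  /-- `υ_j^{zz}`. -/
  υzz : ℕ → ℝ
  /-- `υ_j^{zμ}`. -/
  υzμ : ℕ → ℝ

namespace QuadFlowParams

/-- The quadratic flow `φ̄_j(V) = M_j V - (VᵀqⱼᵍV, VᵀqⱼᶻV, VᵀqⱼᵘV)`, i.e. with `V = (g, z, μ)`:
`g ↦ g - β_jg²`, `z ↦ z - θ_jg² - ζ_jgz`,
`μ ↦ η_jg + γ_jz + λ_jμ - υ^{gg}_jg² - υ^{gz}_jgz - υ^{gμ}_jgμ - υ^{zz}_jz² - υ^{zμ}_jzμ`.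
[cite: BauerschmidtBrydgesSlade2015Flow, §1.1, (1.1)–(1.3)] -/
def map (P : QuadFlowParams) (j : ℕ) (V : V3) : V3 :=
  ![V 0 - P.β j * V 0 ^ 2,
    V 1 - (P.θ j * V 0 ^ 2 + P.ζ j * V 0 * V 1),
    P.η j * V 0 + P.γ j * V 1 + P.lam j * V 2 -
      (P.υgg j * V 0 ^ 2 + P.υgz j * V 0 * V 1 + P.υgμ j * V 0 * V 2 + P.υzz j * V 1 ^ 2 +
        P.υzμ j * V 1 * V 2)]

variable (P : QuadFlowParams) (j : ℕ) (V : V3)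

/-- The `g`-component of `φ̄_j`. [cite: BauerschmidtBrydgesSlade2015Flow, (1.1)–(1.2)] -/
@[simp] theorem map_apply_zero : P.map j V 0 = V 0 - P.β j * V 0 ^ 2 := rfl

/-- The `z`-component of `φ̄_j`. [cite: BauerschmidtBrydgesSlade2015Flow, (1.1)–(1.2)] -/
@[simp] theorem map_apply_one : P.map j V 1 = V 1 - (P.θ j * V 0 ^ 2 + P.ζ j * V 0 * V 1) := rfl

/-- The `μ`-component of `φ̄_j`. [cite: BauerschmidtBrydgesSlade2015Flow, (1.1) and (1.3)] -/
@[simp] theorem map_apply_two :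
    P.map j V 2 = P.η j * V 0 + P.γ j * V 1 + P.lam j * V 2 -
      (P.υgg j * V 0 ^ 2 + P.υgz j * V 0 * V 1 + P.υgμ j * V 0 * V 2 + P.υzz j * V 1 ^ 2 +
        P.υzμ j * V 1 * V 2) := rfl

/-- `φ̄_j(0) = 0`: the origin is a fixed point. [cite: BauerschmidtBrydgesSlade2015Flow, §1.2 ("By definition, φ̄_j(0) = 0")] -/
@[simp] theorem map_zero : P.map j 0 = 0 := by
  ext i; fin_cases i <;> simp [map]

/-- The `g`-component of a flow of `φ̄` is the recursion `ḡ` of `WeaklySAWCouplingFlow.lean`: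
if `V_{j+1} = φ̄_j(V_j)` for all `j` then `V_j 0 = gbar β (V₀ 0) j`.
[cite: BauerschmidtBrydgesSlade2015Flow, §1.3, (1.6)] -/
theorem flow_apply_zero_eq_gbar {P : QuadFlowParams} {Vb : ℕ → V3}
    (hflow : ∀ j, Vb (j + 1) = P.map j (Vb j)) (j : ℕ) : Vb j 0 = gbar P.β (Vb 0 0) j := by
  induction j with
  | zero => simp
  | succ j ih => rw [hflow j, map_apply_zero, gbar_succ, ih]

end QuadFlowParams

/-! ### `β_max`, the `Ω`-cut-off time `j_Ω` and the weights `χ_j` -/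

/-- `β_max = sup_{j ≥ 0} |β_j|` (the real supremum; it is the junk value `0` when `β` is unbounded,
which Assumption (A1) excludes). [cite: BauerschmidtBrydgesSlade2015Flow, §1.3 (before (1.7))] -/
def betaMax (β : ℕ → ℝ) : ℝ := ⨆ j, |β j|

/-- The `Ω`-cut-off time `j_Ω = inf{k ≥ 0 : |β_j| ≤ Ω^{-(j-k)₊} β_max for all j ≥ 0} ∈ ℕ ∪ {∞}`
(infimum of the empty set `= ∞`). Here `(j-k)₊` is truncated subtraction of naturals, and
`Ω^{-(j-k)₊} = (Ω^{(j-k)₊})⁻¹`. [cite: BauerschmidtBrydgesSlade2015Flow, §1.3, (1.7)]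
[cite: BauerschmidtBrydgesSlade2015LogCorr, §6.1 (the Ω-scale j_Ω)] -/
def jOmega (β : ℕ → ℝ) (Ω : ℝ) : ℕ∞ :=
  ⨅ (k : ℕ) (_ : ∀ j, |β j| ≤ (Ω ^ (j - k))⁻¹ * betaMax β), (k : ℕ∞)

/-- The weight `Ω^{-(j-k)₊}` attached to a cut-off time `k ∈ ℕ ∪ {∞}` (`= 1` for `k = ∞`).
[cite: BauerschmidtBrydgesSlade2015Flow, §1.3, (1.8)] -/
def cutoffWeight (Ω : ℝ) (k : ℕ∞) (j : ℕ) : ℝ :=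
  if k = ⊤ then 1 else (Ω ^ (j - k.toNat))⁻¹

/-- `χ_j = Ω^{-(j-j_Ω)₊}` (so `χ_j = 1` for all `j` when `j_Ω = ∞`).
[cite: BauerschmidtBrydgesSlade2015Flow, §1.3, (1.8)] [cite: BauerschmidtBrydgesSlade2015LogCorr, §6.1 (χ_j)] -/
def chi (β : ℕ → ℝ) (Ω : ℝ) (j : ℕ) : ℝ := cutoffWeight Ω (jOmega β Ω) j

/-- `Ω^{-(j-∞)₊} = 1`. [cite: BauerschmidtBrydgesSlade2015Flow, §1.3 (after (A2): "j_Ω = ∞, for which χ_j = 1 for all j")] -/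
@[simp] theorem cutoffWeight_top (Ω : ℝ) (j : ℕ) : cutoffWeight Ω ⊤ j = 1 := by
  simp [cutoffWeight]

/-- `Ω^{-(j-k)₊} = (Ω^{j-k})⁻¹` for finite `k`. [cite: BauerschmidtBrydgesSlade2015Flow, §1.3, (1.8)] -/
@[simp] theorem cutoffWeight_coe (Ω : ℝ) (k j : ℕ) : cutoffWeight Ω (k : ℕ∞) j = (Ω ^ (j - k))⁻¹ := by
  simp [cutoffWeight]

/-- For `j ≤ k` the weight is `1`. [cite: BauerschmidtBrydgesSlade2015Flow, §1.3, (1.8)] -/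
theorem cutoffWeight_eq_one_of_le {Ω : ℝ} {k : ℕ∞} {j : ℕ} (hj : (j : ℕ∞) ≤ k) :
    cutoffWeight Ω k j = 1 := by
  induction k with
  | top => simp
  | coe k => simp [Nat.sub_eq_zero_of_le (by exact_mod_cast hj)]

/-- `0 < Ω^{-(j-k)₊} ≤ 1` for `Ω ≥ 1`. [cite: BauerschmidtBrydgesSlade2015Flow, §1.3, (1.8)] -/
theorem cutoffWeight_pos_and_le_one {Ω : ℝ} (hΩ : 1 ≤ Ω) (k : ℕ∞) (j : ℕ) :
    0 < cutoffWeight Ω k j ∧ cutoffWeight Ω k j ≤ 1 := by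
  induction k with
  | top => simp
  | coe k =>
    simp only [cutoffWeight_coe]
    exact ⟨inv_pos.2 (pow_pos (by linarith) _), inv_le_one_of_one_le₀ (one_le_pow₀ hΩ)⟩

/-- The weights are non-increasing in `j` (for `Ω ≥ 1`). [cite: BauerschmidtBrydgesSlade2015Flow, §1.3, (1.8)] -/
theorem cutoffWeight_succ_le {Ω : ℝ} (hΩ : 1 ≤ Ω) (k : ℕ∞) (j : ℕ) :
    cutoffWeight Ω k (j + 1) ≤ cutoffWeight Ω k j := by
  induction k with
  | top => simp
  | coe k =>
    simp only [cutoffWeight_coe]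
    have h0 : 0 < Ω := by linarith
    refine inv_anti₀ (pow_pos h0 _) (pow_le_pow_right₀ hΩ ?_)
    omega

/-- `χ_j/χ_{j+1} ≤ Ω`, i.e. `χ_j ≤ Ω χ_{j+1}` (for `Ω ≥ 1`). [cite: BauerschmidtBrydgesSlade2015Flow, Lemma 3.3 (proof: "χ_j/χ_{j+1} ≤ Ω by (1.8)")] -/
theorem cutoffWeight_le_mul_succ {Ω : ℝ} (hΩ : 1 ≤ Ω) (k : ℕ∞) (j : ℕ) :
    cutoffWeight Ω k j ≤ Ω * cutoffWeight Ω k (j + 1) := by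
  have h0 : 0 < Ω := by linarith
  induction k with
  | top => simpa using hΩ
  | coe k =>
    simp only [cutoffWeight_coe]
    rcases le_or_gt (j + 1) k with hjk | hjk
    · rw [Nat.sub_eq_zero_of_le hjk, Nat.sub_eq_zero_of_le (Nat.le_of_succ_le hjk)]
      simpa using hΩ
    · have h1 : j + 1 - k = (j - k) + 1 := by omega
      have h2 : Ω * (Ω ^ (j + 1 - k))⁻¹ = (Ω ^ (j - k))⁻¹ := by
        rw [h1, pow_succ]; field_simp
      rw [h2]

/-- `χ_j = 1` for `j ≤ j_Ω`. [cite: BauerschmidtBrydgesSlade2015Flow, §1.3, (1.8)] -/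
theorem chi_eq_one_of_le {β : ℕ → ℝ} {Ω : ℝ} {j : ℕ} (hj : (j : ℕ∞) ≤ jOmega β Ω) : chi β Ω j = 1 :=
  cutoffWeight_eq_one_of_le hj

/-- `0 < χ_j ≤ 1` (for `Ω ≥ 1`). [cite: BauerschmidtBrydgesSlade2015Flow, §1.3, (1.8)] -/
theorem chi_pos_and_le_one (β : ℕ → ℝ) {Ω : ℝ} (hΩ : 1 ≤ Ω) (j : ℕ) : 0 < chi β Ω j ∧ chi β Ω j ≤ 1 :=
  cutoffWeight_pos_and_le_one hΩ _ j

/-- Admissibility of a cut-off is monotone: if `|β_j| ≤ Ω^{-(j-k)₊}β_max` for all `j` and `k ≤ k'`,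
the same holds with `k'` (for `Ω ≥ 1`). [cite: BauerschmidtBrydgesSlade2015Flow, §1.3 (after (1.7))] -/
theorem cutoff_admissible_mono {β : ℕ → ℝ} {Ω : ℝ} (hΩ : 1 ≤ Ω) {k k' : ℕ} (hkk' : k ≤ k')
    (hk : ∀ j, |β j| ≤ (Ω ^ (j - k))⁻¹ * betaMax β) (j : ℕ) : |β j| ≤ (Ω ^ (j - k'))⁻¹ * betaMax β := by
  have hB : 0 ≤ betaMax β := by
    have := hk 0
    have h1 : 0 < (Ω ^ (0 - k))⁻¹ := by positivity
    nlinarith [abs_nonneg (β 0)]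
  refine (hk j).trans (mul_le_mul_of_nonneg_right ?_ hB)
  have h0 : 0 < Ω := by linarith
  exact inv_anti₀ (pow_pos h0 _) (pow_le_pow_right₀ hΩ (by omega))

/-- The infimum defining `j_Ω` is attained when finite: if `j_Ω = k < ∞` then
`|β_j| ≤ Ω^{-(j-k)₊} β_max` for all `j`. [cite: BauerschmidtBrydgesSlade2015Flow, §1.3, (1.7)] -/
theorem jOmega_spec {β : ℕ → ℝ} {Ω : ℝ} {k : ℕ} (hk : jOmega β Ω = k) (j : ℕ) :
    |β j| ≤ (Ω ^ (j - k))⁻¹ * betaMax β := by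
  classical
  -- the admissible set is a nonempty up-set of `ℕ`; its infimum in `ℕ∞` is its least element
  set S : Set ℕ := {k | ∀ j, |β j| ≤ (Ω ^ (j - k))⁻¹ * betaMax β} with hS
  have hinf : jOmega β Ω = ⨅ k ∈ S, (k : ℕ∞) := rfl
  by_cases hne : S.Nonempty
  · have hmem : sInf S ∈ S := Nat.sInf_mem hne
    have hle : (⨅ k ∈ S, (k : ℕ∞)) ≤ (sInf S : ℕ) := iInf₂_le _ hmem
    have hge : ((sInf S : ℕ) : ℕ∞) ≤ ⨅ k ∈ S, (k : ℕ∞) :=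
      le_iInf₂ fun k hk' => by exact_mod_cast Nat.sInf_le hk'
    have heq : (k : ℕ∞) = (sInf S : ℕ) := by rw [← hk, hinf]; exact le_antisymm hle hge
    have hk' : k = sInf S := by exact_mod_cast heq
    subst hk'
    exact hmem j
  · exfalso
    have : jOmega β Ω = ⊤ := by
      rw [hinf]
      simp only [iInf_eq_top, ENat.coe_ne_top, imp_false]
      exact fun k hk' => hne ⟨k, hk'⟩
    rw [this] at hk
    exact ENat.top_ne_coe k hk

/-- Under boundedness of `β` (Assumption (A1)): `|β_j| ≤ χ_j β_max` for all `j`.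
[cite: BauerschmidtBrydgesSlade2015Flow, §1.3, (1.7)–(1.8)] -/
theorem abs_le_chi_mul_betaMax {β : ℕ → ℝ} (hb : BddAbove (Set.range fun j => |β j|)) (Ω : ℝ)
    (j : ℕ) : |β j| ≤ chi β Ω j * betaMax β := by
  unfold chi
  induction h : jOmega β Ω with
  | top => rw [cutoffWeight_top, one_mul]; exact le_ciSup hb j
  | coe k => simpa using jOmega_spec h j

/-- Example 1.1(i) of the source: for a constant sequence `β_j = b ≠ 0` and `Ω > 1`, `j_Ω = ∞`.
[cite: BauerschmidtBrydgesSlade2015Flow, Example 1.1(i) and §1.3 ("if β_j = b for all j then j_Ω = ∞")] -/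
theorem jOmega_const {b Ω : ℝ} (hb : b ≠ 0) (hΩ : 1 < Ω) : jOmega (fun _ => b) Ω = ⊤ := by
  unfold jOmega
  simp only [iInf_eq_top, ENat.coe_ne_top, imp_false]
  intro k hk
  have hmax : betaMax (fun _ => b) = |b| := by simp [betaMax]
  have := hk (k + 1)
  rw [hmax, Nat.add_sub_cancel_left, pow_one] at this
  have hbpos : 0 < |b| := abs_pos.2 hb
  have : (1 : ℝ) ≤ Ω⁻¹ := by
    by_contra hcon
    have hcon' : Ω⁻¹ < 1 := lt_of_not_ge hcon
    nlinarith
  have : Ω ≤ 1 := by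
    have h0 : 0 < Ω := by linarith
    have := mul_le_mul_of_nonneg_left this h0.le
    rwa [mul_one, mul_inv_cancel₀ h0.ne'] at this
  linarith

/-! ### Assumptions (A1) and (A2) -/

/-- **Assumption (A1)** (the sequence `β`), with its constants explicit: `|β_j| ≤ B` for all `j` (the
source: "`(β_j)` is bounded: `β_max < ∞`"; `B` is any bound, so `β_max ≤ B`), and `c > 0` such that
`β_j ≥ c` for all but at most `c⁻¹` values of `j ≤ j_Ω`.
[cite: BauerschmidtBrydgesSlade2015Flow, Assumption (A1)] [cite: BauerschmidtBrydgesSlade2015LogCorr, §6.1, Assumption (A1)] -/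
structure HypA1 (β : ℕ → ℝ) (Ω B c : ℝ) : Prop where
  /-- boundedness: `|β_j| ≤ B`. -/
  abs_le : ∀ j, |β j| ≤ B
  /-- `c > 0`. -/
  c_pos : 0 < c
  /-- `β_j ≥ c` for all but at most `c⁻¹` values of `j ≤ j_Ω`. -/
  exc : ∃ s : Finset ℕ, (s.card : ℝ) ≤ c⁻¹ ∧ ∀ j : ℕ, (j : ℕ∞) ≤ jOmega β Ω → j ∉ s → c ≤ β j

/-- **Assumption (A2)** (the other parameters of `φ̄`), constants explicit: `λ_j ≥ λ > 1` for all `j`;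
`ζ_j ≤ 0` for all but at most `c⁻¹` values of `j ≤ j_Ω`; each of `η_j, γ_j, θ_j, ζ_j, υ_j^{αβ}` is
bounded in absolute value by `C χ_j` ("`O(χ_j)` with a constant independent of `j` and `j_Ω`").
[cite: BauerschmidtBrydgesSlade2015Flow, Assumption (A2)] [cite: BauerschmidtBrydgesSlade2015LogCorr, §6.1, Assumption (A2)] -/
structure HypA2 (P : QuadFlowParams) (Ω lam c C : ℝ) : Prop where
  /-- `λ > 1`. -/
  one_lt_lam : 1 < lam
  /-- `λ_j ≥ λ`. -/
  lam_le : ∀ j, lam ≤ P.lam j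
  /-- `c > 0`. -/
  c_pos : 0 < c
  /-- `ζ_j ≤ 0` for all but at most `c⁻¹` values of `j ≤ j_Ω`. -/
  zeta_exc : ∃ s : Finset ℕ, (s.card : ℝ) ≤ c⁻¹ ∧ ∀ j : ℕ, (j : ℕ∞) ≤ jOmega P.β Ω → j ∉ s → P.ζ j ≤ 0
  /-- `|η_j| ≤ Cχ_j`. -/
  eta_le : ∀ j, |P.η j| ≤ C * chi P.β Ω j
  /-- `|γ_j| ≤ Cχ_j`. -/
  gamma_le : ∀ j, |P.γ j| ≤ C * chi P.β Ω j
  /-- `|θ_j| ≤ Cχ_j`. -/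
  theta_le : ∀ j, |P.θ j| ≤ C * chi P.β Ω j
  /-- `|ζ_j| ≤ Cχ_j`. -/
  zeta_le : ∀ j, |P.ζ j| ≤ C * chi P.β Ω j
  /-- `|υ_j^{gg}| ≤ Cχ_j`. -/
  υgg_le : ∀ j, |P.υgg j| ≤ C * chi P.β Ω j
  /-- `|υ_j^{gz}| ≤ Cχ_j`. -/
  υgz_le : ∀ j, |P.υgz j| ≤ C * chi P.β Ω j
  /-- `|υ_j^{gμ}| ≤ Cχ_j`. -/
  υgμ_le : ∀ j, |P.υgμ j| ≤ C * chi P.β Ω j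
  /-- `|υ_j^{zz}| ≤ Cχ_j`. -/
  υzz_le : ∀ j, |P.υzz j| ≤ C * chi P.β Ω j
  /-- `|υ_j^{zμ}| ≤ Cχ_j`. -/
  υzμ_le : ∀ j, |P.υzμ j| ≤ C * chi P.β Ω j

/-- "`V̄ = (ḡ_j, z̄_j, μ̄_j)_j` is a global flow of `φ̄` with initial condition `ḡ₀ = g₀` and final
condition `(z̄_∞, μ̄_∞) = (0, 0)`" (`z̄_∞ = lim_j z̄_j`).
[cite: BauerschmidtBrydgesSlade2015Flow, Proposition 1.2 and §2, (2.1)] -/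
def IsQuadFlowBC (P : QuadFlowParams) (g₀ : ℝ) (Vb : ℕ → V3) : Prop :=
  (∀ j, Vb (j + 1) = P.map j (Vb j)) ∧ Vb 0 0 = g₀ ∧
    Tendsto (fun j => Vb j 1) atTop (𝓝 0) ∧ Tendsto (fun j => Vb j 2) atTop (𝓝 0)

end CTWSAW

end Literature.Barriers.CriticalPhenomena
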